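import Mathlib
import HarnessLib
import HarnessLib.Audit
import Summits.AtomisticToContinuum.FouriersLaw.Theses.LogConcaveRigidity
import Literature.MathematicalPhysics.KineticTheory.InfiniteChainInvariantStates
import Literature.MathematicalPhysics.KineticTheory.InfiniteChainObservables

/-!
# `Lines/birth.lean` — birth skeleton (BC3) for crux `LogConcaveLiouville`
(stmt-AtomisticToContinuum-16560; route LogConcaveRigidity, rank 2, difficulty open-problem;
skeleton-register, planner one-shot, 2026-08-17)

THE CRUX (fixed, concluded BY NAME). `LogConcaveLiouville`: for `ω₂, lam, β > 0` (γ inert) every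
probability measure `ν` on `ChainConfig = (ℝ×ℝ)^ℤ` that is time-invariant for the infinite pinned
chain (`∫ 𝒜f dν = 0` on `C₀¹`), translation-BOUNDED (site-uniform moments of every order) and
WINDOW-LOG-CONCAVE (every box marginal satisfies Borell's multiplicative Brunn–Minkowski
inequality), with `j_0 ∈ L¹(ν)`, has `∫ j_0 dν = 0`. Shift-invariance is NOT assumed.

THE SEAM (the route's own TWO-LAYER PLAN "(L1) structure → (L2) census", cut at MOMENTUM
REVERSAL `R : (q, p) ↦ (q, -p)` = `momentumReversalZ`). The bond current is `R`-odd, so an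
`R`-invariant state carries no current for free
(`integral_bondCurrentZ_eq_zero_of_map_momentumReversalZ_eq`, Literature calculus, proved). The
whole content of the crux is therefore: a window-log-concave stationary state of the ANHARMONIC
chain cannot break time-reversal symmetry. Every member of the class found so far (route review
2026-08-16: Gibbs states and their flips, `δ_0`, the periodic-pattern subspace states
`e^{-φ(H_ring)}`) is `R`-invariant; the only known `R`-asymmetric log-concave stationary states of
oscillator chains are HARMONIC (Spohn–Lebowitz radiating Gaussians, `lam = β = 0`) or UNPINNED
(boosted states), and in both cases the asymmetry is carried by an `R`-odd LOCAL conservation law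
(`p_0 (q_1 - q_{-1})`, resp. `p_0`). Hence two registered stubs:

* `stub_noLocalIntegrals` — CENSUS, VERBATIM the open support item stmt-AtomisticToContinuum-12074
  `LocalOhmBV.NoLocalIntegrals` (difficulty L; grounded KNOWN-METHOD: Levi–Yamilov symmetry
  approach, Yamilov 2006; evidence on that item: the first canonical integrability condition fails
  for `V'' = 1 + 3βr²`, and prover c5's exact polynomial census, odd nullity 0 in 117 anharmonic
  windows): for `ω₂, lam, β > 0` every smooth local density whose Liouville derivative is a
  shift-difference is `c·e_0 + (h - h∘τ) + k`. The COMPUTABLE half; it is where anharmonicity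
  enters (false at `lam = β = 0`). Shared with the birth lines of `ZeroCurrentRigidity`
  (stmt-12073) and `BoundedOddRigidity` (stmt-11027): one census serves three rigidity cruxes.
* `stub_oddLawOfReversalAsymmetry` — REVERSAL ASYMMETRY OF A LOG-CONCAVE STATIONARY STATE NEEDS AN
  ODD LOCAL CHARGE (new; the structural half; universal in the four real parameters, no sign
  conditions): if a probability measure on `(ℝ×ℝ)^ℤ` is time-invariant for `pinnedChain ω₂ lam β γ`,
  translation-bounded and window-log-concave, and is NOT invariant under `R`
  (`ν ∘ R⁻¹ ≠ ν`), then the chain admits an `R`-odd smooth local conservation law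
  (`𝒜f = ψ - ψ∘τ`) that is NOT a smooth local shift-coboundary. TRUE with a witness at
  `lam = β = 0` (radiating Gaussian states exist AND `p_0(q_1 - q_{-1})` is an odd law) — exactly
  where the crux FAILS, so it is not the crux in costume; for anharmonic pinned parameters it is
  the open heart: "inside the log-concave class, odd structure of a stationary state is protected
  by a local odd charge or it is absent" (the log-concave, translation-bounded, NOT shift-invariant
  analogue of the sibling stub `ZeroCurrentRigidity.Birth.stub_oddLawOfCurrent`, and STRONGER than
  its current-level form: its hypothesis is any `R`-asymmetry, not a non-zero mean current).

COMPOSITION `LogConcaveLiouville_of : stub₁ → stub₂ → LogConcaveRigidity.LogConcaveLiouville`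
(real proof, no `sorry`): by contradiction, `∫ j_0 dν ≠ 0` forces `ν ∘ R⁻¹ ≠ ν` (odd current,
Literature lemma); stub 2 gives an odd local law `f` that is not a coboundary; the census writes
`f = c·e_0 + (h - h∘τ) + k`; `e_0 ∘ R = e_0` and `τ ∘ R = R ∘ τ`, so oddness gives
`f = ½(f - f∘R) = g - g∘τ` with the smooth local `g = ½(h - h∘R)` — a coboundary after all.
(The parity algebra is adapted, with acknowledgement, from
`Cruxes/ZeroCurrentRigidity/Lines/birth.lean`.)

WHY THIS CUT IS EASIER THAN THE CRUX (transfer note). Stub 2 replaces a statement about ONE odd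
observable by a statement about the full odd sector of the state, which is what convexity tools
address: the window potentials `W_Λ = -log(dν_Λ/dz)` (on the affine hull of the convex support)
split as `W_Λ = W_Λ^e + W_Λ^o` under `R`, the even part convex and dominating the odd part
(even/odd domination of the card), and the projected Liouville equations are `R`-graded; an
`R`-asymmetry is a non-zero consistent family `(W_Λ^o)_Λ` — a tame quasi-local odd conserved
structure — whose LOCAL shadow is what stub 2 asks for and what the census kills.

CALIBRATIONS / NEGATIVES HONOURED. Harmonic member (`HarmonicChainBallisticFlux`,
SpohnLebowitz1977): stub 2 HOLDS (with witness), stub 1 FAILS — the skeleton cannot prove the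
false harmonic instance, and anharmonicity is used exactly once, in the census. `Disproof.lean` /
`Negative/`: none exist for this crux (`ledger crux ls stmt-AtomisticToContinuum-16560`: no
workfiles, 2026-08-17) — nothing to honour; the route-review refuter's in-class census (all
candidates `R`-invariant, zero current) is positive evidence FOR stub 2. Negatives index of the
summit (20 entries): no statement about local conservation laws, momentum reversal or log-concave
states.

BC3 PROBES (unit folder `bc/`): for each stub `S`, `S → LogConcaveLiouville` and `S → FouriersLaw`
by `first | exact? | simpa | simpa [S] | (unfold S; simpa) | aesop` FAIL (see `Lines/birth.md`).
-/

noncomputable section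

namespace Summit.AtomisticToContinuum.FouriersLaw.Cruxes.LogConcaveLiouville.Birth

open MeasureTheory
open Literature.MathematicalPhysics.KineticTheory.HeatConduction

/-! ## Registered stubs (the only `sorry`s of the line) -/

/-- **stub 1 · `stub_noLocalIntegrals` — NO LOCAL CONSERVATION LAW BESIDES ENERGY** (verbatim the
statement of item stmt-AtomisticToContinuum-12074 `LocalOhmBV.NoLocalIntegrals`; size L). For
`ω₂, lam, β > 0`, every smooth local density `f = g ∘ boxRestrict R` (`g ∈ C^∞`) whose Liouville
derivative is a total shift-difference `𝒜f = ψ - ψ ∘ τ` (`ψ` smooth local) is of the form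
`c·e_0 + (h - h∘τ) + k`, `e_0 = p_0²/2 + U(q_0) + V(q_1 - q_0)`, `h` smooth local, `c, k ∈ ℝ`.
Why plausibly true: symmetry approach to lattice equations `q̈_n = F(q_{n-1}, q_n, q_{n+1})`
(Levi–Yamilov 1997, Yamilov 2006): a conservation law of order ≥ 3 forces the first canonical
integrability condition, which fails for `V''(r) = 1 + 3βr²`, `β > 0`; low orders by hand; exact
polynomial census (prover c5, evidence on 12074). Why it might fail: the printed necessity of the
canonical conditions covers the Toda-type class under non-degeneracy hypotheses verified for the
quartic pinned member only by hand; a non-polynomial local law is outside the census. False at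
`lam = β = 0` (quadratic charges). -/
theorem stub_noLocalIntegrals :
    ∀ ω₂ lam β γ : ℝ, 0 < ω₂ → 0 < lam → 0 < β → ∀ f : Literature.MathematicalPhysics.KineticTheory.HeatConduction.ChainConfig → ℝ, (∃ (R : ℕ) (g : (Fin (2 * R + 1) → ℝ × ℝ) → ℝ), ContDiff ℝ ((⊤ : ℕ∞) : WithTop ℕ∞) g ∧ f = g ∘ Literature.MathematicalPhysics.KineticTheory.HeatConduction.boxRestrict R) → (∃ ψ : Literature.MathematicalPhysics.KineticTheory.HeatConduction.ChainConfig → ℝ, (∃ (R : ℕ) (g : (Fin (2 * R + 1) → ℝ × ℝ) → ℝ), ContDiff ℝ ((⊤ : ℕ∞) : WithTop ℕ∞) g ∧ ψ = g ∘ Literature.MathematicalPhysics.KineticTheory.HeatConduction.boxRestrict R) ∧ ∀ σ, Literature.MathematicalPhysics.KineticTheory.HeatConduction.liouvilleZ (Literature.MathematicalPhysics.KineticTheory.HeatConduction.pinnedChain ω₂ lam β γ) f σ = ψ σ - ψ (Literature.MathematicalPhysics.KineticTheory.HeatConduction.shift σ)) → ∃ (c k : ℝ) (h : Literature.MathematicalPhysics.KineticTheory.HeatConduction.ChainConfig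 → ℝ), (∃ (R : ℕ) (g : (Fin (2 * R + 1) → ℝ × ℝ) → ℝ), ContDiff ℝ ((⊤ : ℕ∞) : WithTop ℕ∞) g ∧ h = g ∘ Literature.MathematicalPhysics.KineticTheory.HeatConduction.boxRestrict R) ∧ ∀ σ, f σ = c * ((σ 0).2 ^ 2 / 2 + (Literature.MathematicalPhysics.KineticTheory.HeatConduction.pinnedChain ω₂ lam β γ).U (σ 0).1 + (Literature.MathematicalPhysics.KineticTheory.HeatConduction.pinnedChain ω₂ lam β γ).V ((σ 1).1 - (σ 0).1)) + (h σ - h (Literature.MathematicalPhysics.KineticTheory.HeatConduction.shift σ)) + k := by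
  sorry

/-- **stub 2 · `stub_oddLawOfReversalAsymmetry` — REVERSAL ASYMMETRY OF A LOG-CONCAVE STATIONARY
STATE NEEDS AN ODD LOCAL CHARGE** (new; the structural half; universal in the parameters — no
sign conditions). For any real `ω₂ lam β γ`: if a probability measure `ν` on `(ℝ×ℝ)^ℤ` is
time-invariant for the infinite chain `pinnedChain ω₂ lam β γ` (generator sense), translation-
bounded (site-uniform moments of every order) and window-log-concave (Borell's inequality for
every box marginal), and `ν ∘ R⁻¹ ≠ ν` for the momentum reversal `R = momentumReversalZ`, then
there is a smooth local density `f` which is ODD under `R`, is a local conservation law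
(`𝒜f = ψ - ψ∘τ`, `ψ` smooth local), and is NOT a shift-coboundary `g - g∘τ` of a smooth local
`g`. Why plausibly true: the only `R`-asymmetric log-concave stationary states of oscillator
chains known are harmonic (Spohn–Lebowitz radiating Gaussians; witness `f = p_0(q_1 - q_{-1})`,
so the stub is TRUE at `lam = β = 0`) or unpinned (boosted states; witness `p_0`); every member of
the anharmonic class exhibited so far (Gibbs, flips, `δ_0`, periodic-subspace states
`e^{-φ(H_ring)}`) is `R`-invariant; convexity makes the odd part of every window potential a
tame object dominated by the convex even part, and KAM / breather / travelling-wave states (the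
catalogued obstruction, FFL94 p. 215) have non-convex window supports and are outside the class.
Why it might fail: an `R`-asymmetric log-concave stationary state protected by a QUASI-local or
ring-periodic odd charge with no strictly local shadow, or an asymmetry in higher odd moments with
zero mean current and no charge at all. Size: open (the heart of the line for anharmonic pinned
parameters); M for the harmonic / unpinned instances. -/
theorem stub_oddLawOfReversalAsymmetry :
    ∀ ω₂ lam β γ : ℝ, ∀ ν : MeasureTheory.Measure Literature.MathematicalPhysics.KineticTheory.HeatConduction.ChainConfig, MeasureTheory.IsProbabilityMeasure ν → Literature.MathematicalPhysics.KineticTheory.HeatConduction.IsTimeInvariant (Literature.MathematicalPhysics.KineticTheory.HeatConduction.pinnedChain ω₂ lam β γ) ν → (∀ m : ℕ, ∃ C : ℝ, ∀ x : ℤ, MeasureTheory.Integrable (fun σ => |(σ x).1| ^ m + |(σ x).2| ^ m) ν ∧ ∫ σ, (|(σ x).1| ^ m + |(σ x).2| ^ m) ∂ν ≤ C) → (∀ (a : ℤ) (n : ℕ), ∀ (A B : Set (Fin (n + 1) → ℝ × ℝ)) (θ : ℝ), MeasurableSet A → MeasurableSet B → 0 < θ → θ < 1 → (Literature.MathematicalPhysics.KineticTheory.HeatConduction.boxMarginal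 a n ν) A ^ θ * (Literature.MathematicalPhysics.KineticTheory.HeatConduction.boxMarginal a n ν) B ^ (1 - θ) ≤ (Literature.MathematicalPhysics.KineticTheory.HeatConduction.boxMarginal a n ν) {z | ∃ x ∈ A, ∃ y ∈ B, z = θ • x + (1 - θ) • y}) → ν.map (⇑Literature.MathematicalPhysics.KineticTheory.HeatConduction.momentumReversalZ) ≠ ν → ∃ f : Literature.MathematicalPhysics.KineticTheory.HeatConduction.ChainConfig → ℝ, (∃ (R : ℕ) (g : (Fin (2 * R + 1) → ℝ × ℝ) → ℝ), ContDiff ℝ ((⊤ : ℕ∞) : WithTop ℕ∞) g ∧ f = g ∘ Literature.MathematicalPhysics.KineticTheory.HeatConduction.boxRestrict R) ∧ (∀ σ : Literature.MathematicalPhysics.KineticTheory.HeatConduction.ChainConfig, f (fun x => ((σ x).1, -(σ x).2)) = -f σ) ∧ (∃ ψ : Literature.MathematicalPhysics.KineticTheory.HeatConduction.ChainConfig → ℝ, (∃ (R : ℕ) (g : (Fin (2 * R + 1) → ℝ × ℝ) → ℝ), ContDiff ℝ ((⊤ : ℕ∞) : WithTop ℕ∞) g ∧ ψ = g ∘ Literature.MathematicalPhysics.KineticTheory.HeatConduction.boxRestrict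 R) ∧ ∀ σ, Literature.MathematicalPhysics.KineticTheory.HeatConduction.liouvilleZ (Literature.MathematicalPhysics.KineticTheory.HeatConduction.pinnedChain ω₂ lam β γ) f σ = ψ σ - ψ (Literature.MathematicalPhysics.KineticTheory.HeatConduction.shift σ)) ∧ ¬ ∃ h : Literature.MathematicalPhysics.KineticTheory.HeatConduction.ChainConfig → ℝ, (∃ (R : ℕ) (g : (Fin (2 * R + 1) → ℝ × ℝ) → ℝ), ContDiff ℝ ((⊤ : ℕ∞) : WithTop ℕ∞) g ∧ h = g ∘ Literature.MathematicalPhysics.KineticTheory.HeatConduction.boxRestrict R) ∧ ∀ σ, f σ = h σ - h (Literature.MathematicalPhysics.KineticTheory.HeatConduction.shift σ) := by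
  sorry

/-! ## Name-keyed aliases of the two statements (the hypothesis types of the composition)

`Registered.stub_*` is VERBATIM the statement of the theorem `stub_*` above (the wiring `example`
at the end certifies it definitionally); the composition takes the stubs as hypotheses BY NAME. -/

namespace Registered

/-- Verbatim statement of `stub_noLocalIntegrals` (= item stmt-AtomisticToContinuum-12074). -/
def stub_noLocalIntegrals : Prop :=
  ∀ ω₂ lam β γ : ℝ, 0 < ω₂ → 0 < lam → 0 < β → ∀ f : Literature.MathematicalPhysics.KineticTheory.HeatConduction.ChainConfig → ℝ, (∃ (R : ℕ) (g : (Fin (2 * R + 1) → ℝ × ℝ) → ℝ), ContDiff ℝ ((⊤ : ℕ∞) : WithTop ℕ∞) g ∧ f = g ∘ Literature.MathematicalPhysics.KineticTheory.HeatConduction.boxRestrict R) → (∃ ψ : Literature.MathematicalPhysics.KineticTheory.HeatConduction.ChainConfig → ℝ, (∃ (R : ℕ) (g : (Fin (2 * R + 1) → ℝ × ℝ) → ℝ), ContDiff ℝ ((⊤ : ℕ∞) : WithTop ℕ∞) g ∧ ψ = g ∘ Literature.MathematicalPhysics.KineticTheory.HeatConduction.boxRestrict R) ∧ ∀ σ,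 Literature.MathematicalPhysics.KineticTheory.HeatConduction.liouvilleZ (Literature.MathematicalPhysics.KineticTheory.HeatConduction.pinnedChain ω₂ lam β γ) f σ = ψ σ - ψ (Literature.MathematicalPhysics.KineticTheory.HeatConduction.shift σ)) → ∃ (c k : ℝ) (h : Literature.MathematicalPhysics.KineticTheory.HeatConduction.ChainConfig → ℝ), (∃ (R : ℕ) (g : (Fin (2 * R + 1) → ℝ × ℝ) → ℝ), ContDiff ℝ ((⊤ : ℕ∞) : WithTop ℕ∞) g ∧ h = g ∘ Literature.MathematicalPhysics.KineticTheory.HeatConduction.boxRestrict R) ∧ ∀ σ, f σ = c * ((σ 0).2 ^ 2 / 2 + (Literature.MathematicalPhysics.KineticTheory.HeatConduction.pinnedChain ω₂ lam β γ).U (σ 0).1 + (Literature.MathematicalPhysics.KineticTheory.HeatConduction.pinnedChain ω₂ lam β γ).V ((σ 1).1 - (σ 0).1)) + (h σ - h (Literature.MathematicalPhysics.KineticTheory.HeatConduction.shift σ)) + k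

/-- Verbatim statement of `stub_oddLawOfReversalAsymmetry`. -/
def stub_oddLawOfReversalAsymmetry : Prop :=
  ∀ ω₂ lam β γ : ℝ, ∀ ν : MeasureTheory.Measure Literature.MathematicalPhysics.KineticTheory.HeatConduction.ChainConfig, MeasureTheory.IsProbabilityMeasure ν → Literature.MathematicalPhysics.KineticTheory.HeatConduction.IsTimeInvariant (Literature.MathematicalPhysics.KineticTheory.HeatConduction.pinnedChain ω₂ lam β γ) ν → (∀ m : ℕ, ∃ C : ℝ, ∀ x : ℤ, MeasureTheory.Integrable (fun σ => |(σ x).1| ^ m + |(σ x).2| ^ m) ν ∧ ∫ σ, (|(σ x).1| ^ m + |(σ x).2| ^ m) ∂ν ≤ C) → (∀ (a : ℤ) (n : ℕ), ∀ (A B : Set (Fin (n + 1) → ℝ × ℝ)) (θ : ℝ), MeasurableSet A → MeasurableSet B → 0 < θ → θ < 1 → (Literature.MathematicalPhysics.KineticTheory.HeatConduction.boxMarginal a n ν) A ^ θ * (Literature.MathematicalPhysics.KineticTheory.HeatConduction.boxMarginal a n ν) B ^ (1 - θ) ≤ (Literature.MathematicalPhysics.KineticTheory.HeatConduction.boxMarginal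 a n ν) {z | ∃ x ∈ A, ∃ y ∈ B, z = θ • x + (1 - θ) • y}) → ν.map (⇑Literature.MathematicalPhysics.KineticTheory.HeatConduction.momentumReversalZ) ≠ ν → ∃ f : Literature.MathematicalPhysics.KineticTheory.HeatConduction.ChainConfig → ℝ, (∃ (R : ℕ) (g : (Fin (2 * R + 1) → ℝ × ℝ) → ℝ), ContDiff ℝ ((⊤ : ℕ∞) : WithTop ℕ∞) g ∧ f = g ∘ Literature.MathematicalPhysics.KineticTheory.HeatConduction.boxRestrict R) ∧ (∀ σ : Literature.MathematicalPhysics.KineticTheory.HeatConduction.ChainConfig, f (fun x => ((σ x).1, -(σ x).2)) = -f σ) ∧ (∃ ψ : Literature.MathematicalPhysics.KineticTheory.HeatConduction.ChainConfig → ℝ, (∃ (R : ℕ) (g : (Fin (2 * R + 1) → ℝ × ℝ) → ℝ), ContDiff ℝ ((⊤ : ℕ∞) : WithTop ℕ∞) g ∧ ψ = g ∘ Literature.MathematicalPhysics.KineticTheory.HeatConduction.boxRestrict R) ∧ ∀ σ, Literature.MathematicalPhysics.KineticTheory.HeatConduction.liouvilleZ (Literature.MathematicalPhysics.KineticTheory.HeatConduction.pinnedChain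 ω₂ lam β γ) f σ = ψ σ - ψ (Literature.MathematicalPhysics.KineticTheory.HeatConduction.shift σ)) ∧ ¬ ∃ h : Literature.MathematicalPhysics.KineticTheory.HeatConduction.ChainConfig → ℝ, (∃ (R : ℕ) (g : (Fin (2 * R + 1) → ℝ × ℝ) → ℝ), ContDiff ℝ ((⊤ : ℕ∞) : WithTop ℕ∞) g ∧ h = g ∘ Literature.MathematicalPhysics.KineticTheory.HeatConduction.boxRestrict R) ∧ ∀ σ, f σ = h σ - h (Literature.MathematicalPhysics.KineticTheory.HeatConduction.shift σ)

end Registered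

/-! ## The composition: the two stubs give the crux BY NAME (no `sorry` below) -/

/-- **`LogConcaveLiouville` from the two stubs.** By contradiction: `∫ j_0 dν ≠ 0` forces
`ν ∘ R⁻¹ ≠ ν` (an `R`-invariant state has zero mean bond current, `j_0` being `R`-odd —
`integral_bondCurrentZ_eq_zero_of_map_momentumReversalZ_eq`); stub 2 then yields an `R`-odd
smooth local conservation law `f` that is not a coboundary; the census (stub 1, which is where
`ω₂, lam, β > 0` is used) writes `f = c·e_0 + (h - h∘τ) + k`; `e_0` is `R`-even and
`τ (Rσ) = R (τσ)`, so `f = ½(f - f∘R) = g - g∘τ` with `g = ½(h - h∘R)`, which is smooth local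
(`h∘R = (G ∘ R_box) ∘ boxRestrict R₀` for the linear box reversal `R_box`) — a coboundary after
all. (Parity algebra adapted from `Cruxes/ZeroCurrentRigidity/Lines/birth.lean`.) -/
theorem LogConcaveLiouville_of (h1 : Registered.stub_noLocalIntegrals)
    (h2 : Registered.stub_oddLawOfReversalAsymmetry) :
    Summit.AtomisticToContinuum.FouriersLaw.Theses.LogConcaveRigidity.LogConcaveLiouville := by
  intro ω₂ lam β γ hω hl hβ ν hprob htime hmom hlc hint
  by_contra hJ
  -- an `R`-invariant state would carry zero current: so `ν` is `R`-asymmetric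
  have hR : ν.map (⇑momentumReversalZ) ≠ ν := fun hsymm =>
    hJ (integral_bondCurrentZ_eq_zero_of_map_momentumReversalZ_eq (pinnedChain ω₂ lam β γ) hsymm 0)
  obtain ⟨f, hfloc, hodd, hcons, hnot⟩ := h2 ω₂ lam β γ ν hprob htime hmom hlc hR
  obtain ⟨c, k, h, ⟨R, G, hG, hhG⟩, hform⟩ := h1 ω₂ lam β γ hω hl hβ f hfloc hcons
  apply hnot
  -- the (linear) momentum reversal of the centred box `{-R, …, R}`
  let L : (Fin (2 * R + 1) → ℝ × ℝ) →L[ℝ] (Fin (2 * R + 1) → ℝ × ℝ) :=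
    ContinuousLinearMap.pi fun i =>
      ((ContinuousLinearMap.fst ℝ ℝ ℝ).comp (ContinuousLinearMap.proj i)).prod
        (-((ContinuousLinearMap.snd ℝ ℝ ℝ).comp (ContinuousLinearMap.proj i)))
  have hL : ∀ (y : Fin (2 * R + 1) → ℝ × ℝ) (i : Fin (2 * R + 1)), L y i = ((y i).1, -(y i).2) := by
    intro y i
    simp [L]
  have hbox : ∀ σ : ChainConfig,
      boxRestrict R (fun x => ((σ x).1, -(σ x).2)) = L (boxRestrict R σ) := by
    intro σ
    funext i
    rw [hL]
    rfl
  have hh : ∀ σ : ChainConfig, h σ = G (boxRestrict R σ) := by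
    intro σ
    rw [hhG]
    rfl
  have hhR : ∀ σ : ChainConfig, h (fun x => ((σ x).1, -(σ x).2)) = G (L (boxRestrict R σ)) := by
    intro σ
    rw [hh, hbox]
  refine ⟨fun σ => (h σ - h (fun x => ((σ x).1, -(σ x).2))) / 2,
    ⟨R, fun y => (G y - G (L y)) / 2, ?_, ?_⟩, ?_⟩
  · exact (hG.sub (hG.comp L.contDiff)).div_const 2
  · funext σ
    simp only [Function.comp_apply]
    rw [hhR σ, hh σ]
  · intro σ
    -- the census at `σ` and at `Rσ`, and oddness of `f`
    have e1 := hform σ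
    have e2 := hform (fun x => ((σ x).1, -(σ x).2))
    have e3 := hodd σ
    have hs : shift (fun x => ((σ x).1, -(σ x).2)) =
        fun x => (((shift σ) x).1, -((shift σ) x).2) := by
      funext x
      rfl
    have hE : ((fun x : ℤ => ((σ x).1, -(σ x).2)) 0).2 ^ 2 / 2 +
          (pinnedChain ω₂ lam β γ).U ((fun x : ℤ => ((σ x).1, -(σ x).2)) 0).1 +
          (pinnedChain ω₂ lam β γ).V (((fun x : ℤ => ((σ x).1, -(σ x).2)) 1).1 -
            ((fun x : ℤ => ((σ x).1, -(σ x).2)) 0).1) =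
        (σ 0).2 ^ 2 / 2 + (pinnedChain ω₂ lam β γ).U (σ 0).1 +
          (pinnedChain ω₂ lam β γ).V ((σ 1).1 - (σ 0).1) := by
      simp only [neg_sq]
    rw [hs, hE] at e2
    simp only
    linarith

/-- Wiring check: the two registered stubs feed `LogConcaveLiouville_of` exactly as stated (their
verbatim statements are definitionally the `Registered.*` aliases). An `example`, so that
`LogConcaveLiouville_of` stays the only theorem of the file concluding the crux. -/
example : Summit.AtomisticToContinuum.FouriersLaw.Theses.LogConcaveRigidity.LogConcaveLiouville :=
  LogConcaveLiouville_of stub_noLocalIntegrals stub_oddLawOfReversalAsymmetry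

end Summit.AtomisticToContinuum.FouriersLaw.Cruxes.LogConcaveLiouville.Birth

end
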